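import Summits.AtomisticToContinuum.FouriersLaw.Theses.EmbeddedDrudeMourre
import Literature.MathematicalPhysics.KineticTheory.InfiniteChainAbelWitness
import Literature.MathematicalPhysics.KineticTheory.InfiniteChainAmplitudeScaling

/-!
# Crux `DrudeDissolution` (stmt-AtomisticToContinuum-12593): LOW TEMPERATURE IS WEAK ANHARMONICITY —
# the crux is the weak-coupling germ at unit temperature; load-bearing clauses; the harmonic Mazur charge

Negative-lane structure lemmas of the standing crux disprover (cycle 1), extracted from the crux
workfile `Summits/AtomisticToContinuum/FouriersLaw/Cruxes/DrudeDissolution/Disproof.lean` §1, §3, §4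
(there phrased with the abbreviation `SpectralWitness`; here every statement is spelled out, no
`Prop`-valued definition is introduced). Contents:

* `exists_witness_transport`, `exists_witness_iff_unit_temp` — the amplitude dilation `σ ↦ s • σ`
  (tree: `InfiniteChainGibbsScaling`, `InfiniteChainAmplitudeScaling`) transports SPECTRAL witnesses:
  the current spectral measure scales `σ ↦ s⁴σ`, the window is unchanged, the density becomes
  `s⁴ g`; hence a witness of `pinnedChain ω₂ lam β γ` at `T` exists iff one of
  `pinnedChain ω₂ (lam T) (β T) γ` at temperature `1` exists (ALS06 §2 (2.8)–(2.14));
* `drudeDissolution_iff_gamma_one` (`0 < γ` is decoration), `drudeDissolution_iff_weak_anharmonicity`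
  (THE CRUX ⇔ on every coupling ray `ε ↦ (aε, bε)`, `a, b > 0`, the unit-temperature chains have
  witnesses for all small `ε > 0`), `not_drudeDissolution_iff` (REFUTATION SHAPE: witnesses must
  fail for a sequence `ε_n ↓ 0` in one direction — an isolated bad coupling never refutes);
* `drudeDissolution_false_without_temp_pos` (the guard `0 < T` cannot be dropped: no DLR state at
  `T ≤ 0`), `exists_laxWitness` (Gibbs ↦ probability and `0 < g 0` ↦ `0 ≤ g 0` make the conclusion
  junk-true), `measure_momentum_eq_zero` + `not_identity_flow` (the identity flow is excluded by
  `PreservesMeasure` + the Gibbs clause);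
* `hasDerivAt_bondCurrentZ_harmonic` — the LOCAL CONSERVATION LAW `d/dt j_x = k_x − k_{x+1}` of the
  energy current of the pinned HARMONIC chain (`lam = β = 0`) along every solution: the total
  current is Mazur's conserved charge behind the harmonic Drude atom, i.e. why `0 < lam ∧ 0 < β`
  (jointly) is load-bearing.

Sorry-free; axioms `propext`, `Classical.choice`, `Quot.sound`.
-/

noncomputable section

namespace Summit.AtomisticToContinuum.FouriersLaw.Theorems.DrudeDissolution.Negative

open MeasureTheory Filter Set Topology
open scoped ENNReal
open Literature.MathematicalPhysics.KineticTheory.HeatConduction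
open Literature.Probability.LatticeModels
open Summit.AtomisticToContinuum.FouriersLaw.Theses.EmbeddedDrudeMourre

/-! ## The crux, read back -/

/-- `DrudeDissolution` unfolded (definitional). -/
theorem drudeDissolution_iff :
    DrudeDissolution ↔ ∀ ω₂ lam β γ : ℝ, 0 < ω₂ → 0 < lam → 0 < β → 0 < γ →
      ∃ T₀ : ℝ, 0 < T₀ ∧ ∀ T : ℝ, 0 < T → T < T₀ →
        ∃ (μT : Measure ChainConfig) (D : InfiniteChainDynamics (pinnedChain ω₂ lam β γ)),
          (pinnedChain ω₂ lam β γ).IsChainGibbsMeasure T μT ∧ D.PreservesMeasure μT ∧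
            (∀ t : ℝ, D.HasAbsConvergentCorrelation μT t) ∧
              ∃ σ : Measure ℝ, IsFiniteMeasure σ ∧
                (∀ t : ℝ, D.currentCorrelation μT t = ∫ ω, Real.cos (ω * t) ∂σ) ∧
                  ∃ (δ : ℝ) (g : ℝ → ℝ), 0 < δ ∧ ContinuousOn g (Ioo (-δ) δ) ∧
                    (∀ ω ∈ Ioo (-δ) δ, 0 ≤ g ω) ∧ 0 < g 0 ∧
                      σ.restrict (Ioo (-δ) δ) =
                        (volume.restrict (Ioo (-δ) δ)).withDensity fun ω => ENNReal.ofReal (g ω) :=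
  Iff.rfl

/-! ## Scaling conjugacy of spectral witnesses -/

/-- TRANSPORT along the dilation (`s ≠ 0`): a spectral witness of the `(lam s², β s²)` chain at `T`
yields one of the `(lam, β)` chain at `s² T` (state `μ ∘ S_s⁻¹`, dynamics `smulDynamics`, spectral
measure `s⁴ σ`, same window, density `s⁴ g`). -/
theorem exists_witness_transport {ω₂ lam β γ T s : ℝ} (hs : s ≠ 0)
    (h : ∃ (μT : Measure ChainConfig) (D : InfiniteChainDynamics (pinnedChain ω₂ (lam * s ^ 2) (β * s ^ 2) γ)),
      (pinnedChain ω₂ (lam * s ^ 2) (β * s ^ 2) γ).IsChainGibbsMeasure T μT ∧ D.PreservesMeasure μT ∧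
        (∀ t : ℝ, D.HasAbsConvergentCorrelation μT t) ∧
          ∃ σ : Measure ℝ, IsFiniteMeasure σ ∧
            (∀ t : ℝ, D.currentCorrelation μT t = ∫ ω, Real.cos (ω * t) ∂σ) ∧
              ∃ (δ : ℝ) (g : ℝ → ℝ), 0 < δ ∧ ContinuousOn g (Ioo (-δ) δ) ∧
                (∀ ω ∈ Ioo (-δ) δ, 0 ≤ g ω) ∧ 0 < g 0 ∧
                  σ.restrict (Ioo (-δ) δ) =
                    (volume.restrict (Ioo (-δ) δ)).withDensity fun ω => ENNReal.ofReal (g ω)) :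
    ∃ (μT : Measure ChainConfig) (D : InfiniteChainDynamics (pinnedChain ω₂ lam β γ)),
      (pinnedChain ω₂ lam β γ).IsChainGibbsMeasure (s ^ 2 * T) μT ∧ D.PreservesMeasure μT ∧
        (∀ t : ℝ, D.HasAbsConvergentCorrelation μT t) ∧
          ∃ σ : Measure ℝ, IsFiniteMeasure σ ∧
            (∀ t : ℝ, D.currentCorrelation μT t = ∫ ω, Real.cos (ω * t) ∂σ) ∧
              ∃ (δ : ℝ) (g : ℝ → ℝ), 0 < δ ∧ ContinuousOn g (Ioo (-δ) δ) ∧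
                (∀ ω ∈ Ioo (-δ) δ, 0 ≤ g ω) ∧ 0 < g 0 ∧
                  σ.restrict (Ioo (-δ) δ) =
                    (volume.restrict (Ioo (-δ) δ)).withDensity fun ω => ENNReal.ofReal (g ω) := by
  obtain ⟨μ, D, hG, hP, hAC, σ, hσ, hC, δ, g, hδ, hg, hg0, hgpos, hw⟩ := h
  have hs4 : (0 : ℝ) < s ^ 4 := by positivity
  refine ⟨μ.map (dilEquiv hs), smulDynamics ω₂ lam β γ hs D,
    isChainGibbsMeasure_map_dil ω₂ lam β γ hs hG, preservesMeasure_smulDynamics ω₂ lam β γ hs hP,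
    fun t => (hasAbsConvergentCorrelation_smulDynamics_iff ω₂ lam β γ hs D μ t).2 (hAC t),
    ENNReal.ofReal (s ^ 4) • σ, (by haveI := hσ; exact Measure.smul_finite σ ENNReal.ofReal_ne_top),
    fun t => ?_, δ, fun ω => s ^ 4 * g ω, hδ,
    continuousOn_const.mul hg, fun ω hω => mul_nonneg hs4.le (hg0 ω hω), mul_pos hs4 hgpos, ?_⟩
  · rw [currentCorrelation_smulDynamics, integral_smul_measure, ENNReal.toReal_ofReal hs4.le,
      smul_eq_mul, hC t]
  · rw [Measure.restrict_smul, hw]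
    have : (fun ω => ENNReal.ofReal (s ^ 4 * g ω)) =
        ENNReal.ofReal (s ^ 4) • fun ω => ENNReal.ofReal (g ω) := by
      funext ω
      simp only [Pi.smul_apply, smul_eq_mul]
      rw [ENNReal.ofReal_mul hs4.le]
    rw [this, withDensity_smul' _ _ ENNReal.ofReal_ne_top]

/-- **LOW TEMPERATURE IS WEAK ANHARMONICITY (spectral witnesses).** For `T > 0`, a spectral witness
of `pinnedChain ω₂ lam β γ` at temperature `T` exists iff one of `pinnedChain ω₂ (lam T) (β T) γ` at
temperature `1` exists. -/
theorem exists_witness_iff_unit_temp {ω₂ lam β γ T : ℝ} (hT : 0 < T) :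
    (∃ (μT : Measure ChainConfig) (D : InfiniteChainDynamics (pinnedChain ω₂ lam β γ)),
      (pinnedChain ω₂ lam β γ).IsChainGibbsMeasure T μT ∧ D.PreservesMeasure μT ∧
        (∀ t : ℝ, D.HasAbsConvergentCorrelation μT t) ∧
          ∃ σ : Measure ℝ, IsFiniteMeasure σ ∧
            (∀ t : ℝ, D.currentCorrelation μT t = ∫ ω, Real.cos (ω * t) ∂σ) ∧
              ∃ (δ : ℝ) (g : ℝ → ℝ), 0 < δ ∧ ContinuousOn g (Ioo (-δ) δ) ∧
                (∀ ω ∈ Ioo (-δ) δ, 0 ≤ g ω) ∧ 0 < g 0 ∧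
                  σ.restrict (Ioo (-δ) δ) =
                    (volume.restrict (Ioo (-δ) δ)).withDensity fun ω => ENNReal.ofReal (g ω)) ↔
    ∃ (μT : Measure ChainConfig) (D : InfiniteChainDynamics (pinnedChain ω₂ (lam * T) (β * T) γ)),
      (pinnedChain ω₂ (lam * T) (β * T) γ).IsChainGibbsMeasure 1 μT ∧ D.PreservesMeasure μT ∧
        (∀ t : ℝ, D.HasAbsConvergentCorrelation μT t) ∧
          ∃ σ : Measure ℝ, IsFiniteMeasure σ ∧
            (∀ t : ℝ, D.currentCorrelation μT t = ∫ ω, Real.cos (ω * t) ∂σ) ∧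
              ∃ (δ : ℝ) (g : ℝ → ℝ), 0 < δ ∧ ContinuousOn g (Ioo (-δ) δ) ∧
                (∀ ω ∈ Ioo (-δ) δ, 0 ≤ g ω) ∧ 0 < g 0 ∧
                  σ.restrict (Ioo (-δ) δ) =
                    (volume.restrict (Ioo (-δ) δ)).withDensity fun ω => ENNReal.ofReal (g ω) := by
  have hs : Real.sqrt T ≠ 0 := (Real.sqrt_pos.mpr hT).ne'
  have hs2 : Real.sqrt T ^ 2 = T := Real.sq_sqrt hT.le
  constructor
  · intro h
    have key := exists_witness_transport (ω₂ := ω₂) (lam := lam * T) (β := β * T) (γ := γ) (T := T)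
      (inv_ne_zero hs)
    have e1 : lam * T * (Real.sqrt T)⁻¹ ^ 2 = lam := by rw [inv_pow, hs2]; field_simp
    have e2 : β * T * (Real.sqrt T)⁻¹ ^ 2 = β := by rw [inv_pow, hs2]; field_simp
    have e3 : (Real.sqrt T)⁻¹ ^ 2 * T = 1 := by rw [inv_pow, hs2]; field_simp
    rw [e1, e2, e3] at key
    exact key h
  · intro h
    have key := exists_witness_transport (ω₂ := ω₂) (lam := lam) (β := β) (γ := γ) (T := 1) hs
    rw [hs2, mul_one] at key
    exact key h

/-! ## `γ` is decoration; the weak-anharmonicity form; the refutation shape -/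

/-- **`0 < γ` IS UNNECESSARY**: the crux is its `γ = 1` slice with the hypothesis `0 < γ` deleted
(the bath coupling enters no infinite-chain object; tree `OscillatorChain.transportUV`). -/
theorem drudeDissolution_iff_gamma_one :
    DrudeDissolution ↔ ∀ ω₂ lam β : ℝ, 0 < ω₂ → 0 < lam → 0 < β →
      ∃ T₀ : ℝ, 0 < T₀ ∧ ∀ T : ℝ, 0 < T → T < T₀ →
        ∃ (μT : Measure ChainConfig) (D : InfiniteChainDynamics (pinnedChain ω₂ lam β 1)),
          (pinnedChain ω₂ lam β 1).IsChainGibbsMeasure T μT ∧ D.PreservesMeasure μT ∧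
            (∀ t : ℝ, D.HasAbsConvergentCorrelation μT t) ∧
              ∃ σ : Measure ℝ, IsFiniteMeasure σ ∧
                (∀ t : ℝ, D.currentCorrelation μT t = ∫ ω, Real.cos (ω * t) ∂σ) ∧
                  ∃ (δ : ℝ) (g : ℝ → ℝ), 0 < δ ∧ ContinuousOn g (Ioo (-δ) δ) ∧
                    (∀ ω ∈ Ioo (-δ) δ, 0 ≤ g ω) ∧ 0 < g 0 ∧
                      σ.restrict (Ioo (-δ) δ) =
                        (volume.restrict (Ioo (-δ) δ)).withDensity fun ω => ENNReal.ofReal (g ω) := by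
  -- transport between γ and γ'
  have tr : ∀ (ω₂ lam β γ γ' T : ℝ), (∃ (μT : Measure ChainConfig) (D : InfiniteChainDynamics (pinnedChain ω₂ lam β γ)),
        (pinnedChain ω₂ lam β γ).IsChainGibbsMeasure T μT ∧ D.PreservesMeasure μT ∧
          (∀ t : ℝ, D.HasAbsConvergentCorrelation μT t) ∧
            ∃ σ : Measure ℝ, IsFiniteMeasure σ ∧
              (∀ t : ℝ, D.currentCorrelation μT t = ∫ ω, Real.cos (ω * t) ∂σ) ∧
                ∃ (δ : ℝ) (g : ℝ → ℝ), 0 < δ ∧ ContinuousOn g (Ioo (-δ) δ) ∧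
                  (∀ ω ∈ Ioo (-δ) δ, 0 ≤ g ω) ∧ 0 < g 0 ∧
                    σ.restrict (Ioo (-δ) δ) =
                      (volume.restrict (Ioo (-δ) δ)).withDensity fun ω => ENNReal.ofReal (g ω)) →
      ∃ (μT : Measure ChainConfig) (D : InfiniteChainDynamics (pinnedChain ω₂ lam β γ')),
        (pinnedChain ω₂ lam β γ').IsChainGibbsMeasure T μT ∧ D.PreservesMeasure μT ∧
          (∀ t : ℝ, D.HasAbsConvergentCorrelation μT t) ∧
            ∃ σ : Measure ℝ, IsFiniteMeasure σ ∧
              (∀ t : ℝ, D.currentCorrelation μT t = ∫ ω, Real.cos (ω * t) ∂σ) ∧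
                ∃ (δ : ℝ) (g : ℝ → ℝ), 0 < δ ∧ ContinuousOn g (Ioo (-δ) δ) ∧
                  (∀ ω ∈ Ioo (-δ) δ, 0 ≤ g ω) ∧ 0 < g 0 ∧
                    σ.restrict (Ioo (-δ) δ) =
                      (volume.restrict (Ioo (-δ) δ)).withDensity fun ω => ENNReal.ofReal (g ω) := by
    intro ω₂ lam β γ γ' T h
    have hU : (pinnedChain ω₂ lam β γ).U = (pinnedChain ω₂ lam β γ').U := rfl
    have hV : (pinnedChain ω₂ lam β γ).V = (pinnedChain ω₂ lam β γ').V := rfl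
    obtain ⟨μT, D, hG, hP, hAC, σ, hσ, hC, rest⟩ := h
    refine ⟨μT, OscillatorChain.transportUV hU hV D,
      (OscillatorChain.isChainGibbsMeasure_iff_of_UV hU hV T μT).1 hG,
      (OscillatorChain.preservesMeasure_transportUV_iff hU hV D μT).2 hP,
      fun t => (OscillatorChain.hasAbsConvergentCorrelation_transportUV_iff hU hV D μT t).2 (hAC t),
      σ, hσ, fun t => ?_, rest⟩
    rw [OscillatorChain.currentCorrelation_transportUV]
    exact hC t
  rw [drudeDissolution_iff]
  constructor
  · intro h ω₂ lam β hω hl hβ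
    exact h ω₂ lam β 1 hω hl hβ one_pos
  · intro h ω₂ lam β γ hω hl hβ _
    obtain ⟨T₀, hT₀, hW⟩ := h ω₂ lam β hω hl hβ
    exact ⟨T₀, hT₀, fun T hT hlt => tr ω₂ lam β 1 γ T (hW T hT hlt)⟩

/-- **WEAK-ANHARMONICITY FORM OF THE CRUX.** `DrudeDissolution` is EXACTLY the statement that, at
temperature `1`, every coupling RAY `ε ↦ (a ε, b ε)` (`a, b > 0`) of pinned doubly-quartic chains
carries spectral witnesses on an initial segment `ε ∈ (0, ε₀)` — the dissolution of the harmonic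
Drude atom at small but positive anharmonicity (ALS06 §2 (2.14): "the limit `T → 0` … corresponds
to the limit `λ → 0`"). -/
theorem drudeDissolution_iff_weak_anharmonicity :
    DrudeDissolution ↔ ∀ ω₂ a b : ℝ, 0 < ω₂ → 0 < a → 0 < b →
      ∃ ε₀ : ℝ, 0 < ε₀ ∧ ∀ ε : ℝ, 0 < ε → ε < ε₀ →
        ∃ (μT : Measure ChainConfig) (D : InfiniteChainDynamics (pinnedChain ω₂ (a * ε) (b * ε) 1)),
          (pinnedChain ω₂ (a * ε) (b * ε) 1).IsChainGibbsMeasure 1 μT ∧ D.PreservesMeasure μT ∧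
            (∀ t : ℝ, D.HasAbsConvergentCorrelation μT t) ∧
              ∃ σ : Measure ℝ, IsFiniteMeasure σ ∧
                (∀ t : ℝ, D.currentCorrelation μT t = ∫ ω, Real.cos (ω * t) ∂σ) ∧
                  ∃ (δ : ℝ) (g : ℝ → ℝ), 0 < δ ∧ ContinuousOn g (Ioo (-δ) δ) ∧
                    (∀ ω ∈ Ioo (-δ) δ, 0 ≤ g ω) ∧ 0 < g 0 ∧
                      σ.restrict (Ioo (-δ) δ) =
                        (volume.restrict (Ioo (-δ) δ)).withDensity fun ω => ENNReal.ofReal (g ω) := by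
  rw [drudeDissolution_iff_gamma_one]
  refine forall₃_congr fun ω₂ a b => ?_
  refine imp_congr_right fun _ => imp_congr_right fun _ => imp_congr_right fun _ => ?_
  refine exists_congr fun ε₀ => and_congr_right fun _ => forall_congr' fun ε => ?_
  refine imp_congr_right fun hε => imp_congr_right fun _ => ?_
  exact exists_witness_iff_unit_temp hε

/-- **REFUTATION SHAPE.** `¬ DrudeDissolution` iff in SOME direction `(a, b)` the unit-temperature
chains `pinnedChain ω₂ (aε) (bε) 1` FAIL to have a spectral witness for anharmonicities
`ε` accumulating at `0`: a Drude atom or a singular low-frequency current spectrum persisting at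
ARBITRARILY WEAK non-zero anharmonicity, for every DLR state and every preserving dynamics. -/
theorem not_drudeDissolution_iff :
    ¬ DrudeDissolution ↔ ∃ ω₂ a b : ℝ, 0 < ω₂ ∧ 0 < a ∧ 0 < b ∧
      ∀ ε₀ : ℝ, 0 < ε₀ → ∃ ε : ℝ, 0 < ε ∧ ε < ε₀ ∧
        ¬ ∃ (μT : Measure ChainConfig) (D : InfiniteChainDynamics (pinnedChain ω₂ (a * ε) (b * ε) 1)),
          (pinnedChain ω₂ (a * ε) (b * ε) 1).IsChainGibbsMeasure 1 μT ∧ D.PreservesMeasure μT ∧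
            (∀ t : ℝ, D.HasAbsConvergentCorrelation μT t) ∧
              ∃ σ : Measure ℝ, IsFiniteMeasure σ ∧
                (∀ t : ℝ, D.currentCorrelation μT t = ∫ ω, Real.cos (ω * t) ∂σ) ∧
                  ∃ (δ : ℝ) (g : ℝ → ℝ), 0 < δ ∧ ContinuousOn g (Ioo (-δ) δ) ∧
                    (∀ ω ∈ Ioo (-δ) δ, 0 ≤ g ω) ∧ 0 < g 0 ∧
                      σ.restrict (Ioo (-δ) δ) =
                        (volume.restrict (Ioo (-δ) δ)).withDensity fun ω => ENNReal.ofReal (g ω) := by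
  rw [drudeDissolution_iff_weak_anharmonicity]
  push Not
  rfl

/-! ## Load-bearing clauses -/

/-- **THE GUARD `0 < T` CANNOT BE DROPPED**: with `0 < T →` deleted from the conclusion the
statement is false at every admissible parameter point (no DLR state of `pinnedChain` at `T ≤ 0`:
the Gibbs kernel is the junk measure `0`; tree `isChainGibbsMeasure_pinnedChain_temp_pos`). -/
theorem drudeDissolution_false_without_temp_pos :
    ¬ ∀ ω₂ lam β γ : ℝ, 0 < ω₂ → 0 < lam → 0 < β → 0 < γ →
      ∃ T₀ : ℝ, 0 < T₀ ∧ ∀ T : ℝ, T < T₀ →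
        ∃ (μT : Measure ChainConfig) (D : InfiniteChainDynamics (pinnedChain ω₂ lam β γ)),
          (pinnedChain ω₂ lam β γ).IsChainGibbsMeasure T μT ∧ D.PreservesMeasure μT ∧
            (∀ t : ℝ, D.HasAbsConvergentCorrelation μT t) ∧
              ∃ σ : Measure ℝ, IsFiniteMeasure σ ∧
                (∀ t : ℝ, D.currentCorrelation μT t = ∫ ω, Real.cos (ω * t) ∂σ) ∧
                  ∃ (δ : ℝ) (g : ℝ → ℝ), 0 < δ ∧ ContinuousOn g (Ioo (-δ) δ) ∧
                    (∀ ω ∈ Ioo (-δ) δ, 0 ≤ g ω) ∧ 0 < g 0 ∧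
                      σ.restrict (Ioo (-δ) δ) =
                        (volume.restrict (Ioo (-δ) δ)).withDensity fun ω => ENNReal.ofReal (g ω) := by
  intro h
  obtain ⟨T₀, hT₀, hW⟩ := h 1 1 1 1 one_pos one_pos one_pos one_pos
  obtain ⟨μT, _, hG, -⟩ := hW 0 hT₀
  exact lt_irrefl (0 : ℝ) (isChainGibbsMeasure_pinnedChain_temp_pos zero_le_one zero_le_one zero_le_one hG)

/-- **LAX WITNESSES ARE TRIVIAL**: weaken "Gibbs" to "probability measure" and `0 < g 0` to
`0 ≤ g 0` and the conclusion holds for EVERY chain of the family by junk (Dirac mass at rest, rest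
dynamics, `C ≡ 0`, `σ = 0`, `g = 0`): both clauses are load-bearing for non-triviality. -/
theorem exists_laxWitness (ω₂ lam β γ : ℝ) :
    ∃ (μ : Measure ChainConfig) (D : InfiniteChainDynamics (pinnedChain ω₂ lam β γ)),
      IsProbabilityMeasure μ ∧ D.PreservesMeasure μ ∧ (∀ t : ℝ, D.HasAbsConvergentCorrelation μ t) ∧
        ∃ σ : Measure ℝ, IsFiniteMeasure σ ∧ (∀ t : ℝ, D.currentCorrelation μ t = ∫ ω, Real.cos (ω * t) ∂σ) ∧
          ∃ (δ : ℝ) (g : ℝ → ℝ), 0 < δ ∧ ContinuousOn g (Ioo (-δ) δ) ∧ (∀ ω ∈ Ioo (-δ) δ, 0 ≤ g ω) ∧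
            0 ≤ g 0 ∧ σ.restrict (Ioo (-δ) δ) =
              (volume.restrict (Ioo (-δ) δ)).withDensity fun ω => ENNReal.ofReal (g ω) := by
  have hU := deriv_U_pinnedChain_zero ω₂ lam β γ
  refine ⟨Measure.dirac restConfig, (pinnedChain ω₂ lam β γ).restDynamics hU, inferInstance,
    (pinnedChain ω₂ lam β γ).restDynamics_preserves_dirac hU,
    (pinnedChain ω₂ lam β γ).hasAbsConvergentCorrelation_restDynamics hU, 0, inferInstance,
    fun t => ?_, 1, fun _ => 0, one_pos, continuousOn_const, fun _ _ => le_rfl, le_rfl, ?_⟩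
  · rw [OscillatorChain.currentCorrelation_restDynamics, integral_zero_measure]
  · simp only [Measure.restrict_zero, ENNReal.ofReal_zero]
    rw [show (fun _ : ℝ => (0 : ℝ≥0∞)) = 0 from rfl, withDensity_zero]

/-- **DLR STATES CHARGE NO MOMENTUM HYPERPLANE**: `μ {σ | p₀(σ) = v} = 0` (the kernel in volume
`{0}` is absolutely continuous w.r.t. Lebesgue in `(q₀, p₀)`, and a line has plane measure `0`).
Companion of the tree lemma `IsChainGibbsMeasure.measure_coord_eq_zero` (which is about the point
`σ 0 = v`). -/
theorem measure_momentum_eq_zero {P : OscillatorChain} {T : ℝ} {μ : Measure ChainConfig}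
    (h : P.IsChainGibbsMeasure T μ) (v : ℝ) : μ {σ | (σ 0).2 = v} = 0 := by
  obtain ⟨-, hDLR⟩ := h
  have hA : MeasurableSet {σ : ChainConfig | (σ 0).2 = v} :=
    measurableSet_eq_fun (measurable_snd.comp (measurable_pi_apply 0)) measurable_const
  rw [← hDLR {0} _ hA]
  have hker : ∀ η : ChainConfig, P.chainSpecification T {0} η {σ | (σ 0).2 = v} = 0 := by
    intro η
    show gibbsSpecOfPotential volume P.chainPotential OscillatorChain.chainSupp T⁻¹ {0} η _ = 0
    simp only [gibbsSpecOfPotential]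
    refine tilted_absolutelyContinuous _ _ ?_
    rw [Measure.map_apply (measurable_glueWith _ η) hA]
    have hpre : (fun ζ : (({0} : Finset ℤ)) → ℝ × ℝ => glueWith {0} ζ η) ⁻¹' {σ | (σ 0).2 = v} =
        Set.pi univ (fun _ => {w : ℝ × ℝ | w.2 = v}) := by
      ext ζ
      simp only [mem_preimage, mem_setOf_eq, mem_univ_pi]
      constructor
      · intro hζ i
        obtain ⟨i, hi⟩ := i
        have hi0 : i = 0 := Finset.mem_singleton.mp hi
        subst hi0
        rwa [glueWith_apply_mem _ _ _ hi] at hζ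
      · intro hζ
        rw [glueWith_apply_mem _ _ _ (Finset.mem_singleton_self 0)]
        exact hζ ⟨0, Finset.mem_singleton_self 0⟩
    rw [hpre, Measure.pi_pi]
    apply Finset.prod_eq_zero (Finset.mem_univ ⟨0, Finset.mem_singleton_self 0⟩)
    rw [show ({w : ℝ × ℝ | w.2 = v}) = (univ : Set ℝ) ×ˢ ({v} : Set ℝ) by
        ext ⟨a, b⟩; simp,
      Measure.volume_eq_prod, Measure.prod_prod]
    simp
  simp_rw [hker]
  exact lintegral_zero

/-- **THE IDENTITY FLOW IS EXCLUDED** by `PreservesMeasure` + the Gibbs clause: if every carrier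
point were fixed by the flow, every carrier point would be an equilibrium, so `p₀ = 0` on the
carrier — a `μ`-null event for a DLR state, contradicting `μ(carrier) = 1`. (The route-review
note's informal claim, certified; so `∃ D` is not junk-satisfiable by `flow t = id`.) -/
theorem not_identity_flow {P : OscillatorChain} {T : ℝ} {μ : Measure ChainConfig}
    (hG : P.IsChainGibbsMeasure T μ) (D : InfiniteChainDynamics P) (hP : D.PreservesMeasure μ) :
    ¬ ∀ σ ∈ D.carrier, ∀ t : ℝ, D.flow t σ = σ := by
  intro hid
  have hsub : D.carrier ⊆ {σ | (σ 0).2 = 0} := by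
    intro σ hσ
    have hsol : P.IsSolution fun _ : ℝ => σ := by
      have := D.isSolution σ hσ
      simp only [hid σ hσ] at this
      exact this
    exact OscillatorChain.momenta_zero_of_const_isSolution hsol 0
  have h0 : μ {σ | (σ 0).2 = 0} = 0 := measure_momentum_eq_zero hG 0
  have hae : ∀ᵐ σ ∂μ, σ ∈ ({σ | (σ 0).2 = 0} : Set ChainConfig) := hP.1.mono fun σ hσ => hsub hσ
  have hprob := hG.isProbabilityMeasure
  rw [ae_iff] at hae
  have : μ univ = 0 := by
    have hsplit : (univ : Set ChainConfig) = {σ | (σ 0).2 = 0} ∪ {σ | ¬ σ ∈ ({σ | (σ 0).2 = 0} : Set ChainConfig)} := by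
      ext σ; simp only [mem_univ, mem_union, mem_setOf_eq, true_iff]; exact em _
    rw [hsplit]
    exact measure_union_null h0 hae
  rw [measure_univ] at this
  exact one_ne_zero this

/-! ## The harmonic endpoint: local conservation of the energy current -/

/-- **LOCAL CONSERVATION OF THE HARMONIC ENERGY CURRENT.** Along every solution of the pinned
harmonic chain `pinnedChain ω₂ 0 0 γ` (any `ω₂, γ`), `d/dt j_x = k_x − k_{x+1}` with the CURRENT OF
THE CURRENT `k_x = ½[p_x² − (ω₂+1) q_x² + q_x (q_{x−1} + q_{x+1}) − q_{x−1} q_{x+1}]` (written out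
below at `x` and at `x+1`): the bond current is a locally conserved density, the total current
`Σ_x j_x` is formally a constant of motion — the Mazur charge producing the harmonic Drude atom,
which a window density forbids (`SpectralPairNecessities.not_window_of_conserved`). -/
theorem hasDerivAt_bondCurrentZ_harmonic {ω₂ γ : ℝ} {c : ℝ → ChainConfig}
    (hc : (pinnedChain ω₂ 0 0 γ).IsSolution c) (x : ℤ) (t : ℝ) :
    HasDerivAt (fun s => (pinnedChain ω₂ 0 0 γ).bondCurrentZ (c s) x)
      (((c t x).2 ^ 2 - (ω₂ + 1) * (c t x).1 ^ 2 + (c t x).1 * ((c t (x - 1)).1 + (c t (x + 1)).1)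
          - (c t (x - 1)).1 * (c t (x + 1)).1) / 2 -
        ((c t (x + 1)).2 ^ 2 - (ω₂ + 1) * (c t (x + 1)).1 ^ 2 +
            (c t (x + 1)).1 * ((c t x).1 + (c t (x + 1 + 1)).1) - (c t x).1 * (c t (x + 1 + 1)).1) / 2) t := by
  have hq : ∀ i, HasDerivAt (fun s => (c s i).1) ((c t i).2) t := fun i => (hc i t).1
  have hp : ∀ i, HasDerivAt (fun s => (c s i).2) ((pinnedChain ω₂ 0 0 γ).force (c t) i) t :=
    fun i => (hc i t).2
  have hV : ∀ r, deriv (pinnedChain ω₂ 0 0 γ).V r = r := fun r => by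
    rw [(AmplitudeScaling.hasDerivAt_V ω₂ 0 0 γ r).deriv]; ring
  have hU : ∀ q, deriv (pinnedChain ω₂ 0 0 γ).U q = ω₂ * q := fun q => by
    rw [(AmplitudeScaling.hasDerivAt_U ω₂ 0 0 γ q).deriv]; ring
  have hF : ∀ (σ : ChainConfig) (i : ℤ), (pinnedChain ω₂ 0 0 γ).force σ i =
      -(ω₂ * (σ i).1) + ((σ (i + 1)).1 - (σ i).1) - ((σ i).1 - (σ (i - 1)).1) := fun σ i => by
    rw [OscillatorChain.force_eq, hU, hV, hV]
  have hj : (fun s => (pinnedChain ω₂ 0 0 γ).bondCurrentZ (c s) x) =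
      fun s => -(((c s x).2 + (c s (x + 1)).2) / 2 * ((c s (x + 1)).1 - (c s x).1)) := by
    funext s
    simp only [OscillatorChain.bondCurrentZ, hV]
  rw [hj]
  have h1 := ((hp x).add (hp (x + 1))).div_const 2
  have h2 := (hq (x + 1)).sub (hq x)
  have h3 : HasDerivAt (fun s => -(((c s x).2 + (c s (x + 1)).2) / 2 * ((c s (x + 1)).1 - (c s x).1)))
      (-((((pinnedChain ω₂ 0 0 γ).force (c t) x + (pinnedChain ω₂ 0 0 γ).force (c t) (x + 1)) / 2) *
          ((c t (x + 1)).1 - (c t x).1) +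
        ((c t x).2 + (c t (x + 1)).2) / 2 * ((c t (x + 1)).2 - (c t x).2))) t :=
    (h1.mul h2).neg
  refine h3.congr_deriv ?_
  simp only [hF, add_sub_cancel_right]
  ring

end Summit.AtomisticToContinuum.FouriersLaw.Theorems.DrudeDissolution.Negative

end
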